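import Literature.AlgebraicGeometry.Frobenioids.BaseCategoryTheoreticityDefs
import HarnessLib

/-!
# Frobenioids I, §3: Examples 3.5 and 3.10 (one-object Frobenioids illustrating Theorem 3.4)

Mochizuki, *The geometry of Frobenioids I: the general theory*, Kyushu J. Math. **62** (2008)
293–400, kurims text pp. 69–72 [cite: MochizukiFrdI2008, Ex. 3.5 p.69, Ex. 3.10 p.72]. "One way to
understand the meaning of the conditions imposed in the various portions of Theorem 3.4 is by
considering examples in which some of the conditions hold, but others do not" (p. 69).

The examples are one-object categories given by explicit monoids; we realise them with Mathlib's
`SingleObj` and equip them with their operations `(Base, Div, deg_Fr)` (`PreFrobenioidData`, the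
identification "`C` may be identified with the elementary Frobenioid determined by the monoid on `D` that
assigns … the monoid `ℤ_{≥0}` [with trivial action]" of pp. 69, 72) — which also exhibits concrete MODELS
of the interface `PreFrobenioidData`.

* Ex. 3.5 (Base categories with FSMI-endomorphisms): `D` = one-object category of `𝔽`, `C` = that of
  `𝔽 × 𝔽`, base = first projection, `(Div, deg_Fr)` = the coordinates of the second factor (DEFINED);
  the self-equivalence switching the factors (DEFINED) "clearly fails to preserve pre-steps" (PROVED:
  `Ex35.not_preserves_preSteps`); the claims "every morphism of `D` is FSM", "`1 ∈ ℤ_{≥0} ⊆ 𝔽` is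
  irreducible", "`D` fails to be of FSMFF-type" and "`C` is a Frobenioid of Frobenius-normalized and
  isotropic type, not of group-like type" are typed (`Ex35.claims`; the last needs Def. 1.3 / Prop. 1.5).
* Ex. 3.10 (Non-slim base categories): `D` = one-object category of a group `G`, `C` = that of `G × 𝔽`,
  the self-equivalence `(g, f) ↦ (g · α(f), f)` for `α : 𝔽 → Z(G)` through `N_{≥1}` (DEFINED) fails to
  preserve base-identity endomorphisms of Frobenius type when `α` is nontrivial (typed, `Ex310.claims`).
Not here: Ex. 3.6–3.9 (analogous, with the groups `ℤ ⊕ ⨁ ℤ/p`, `ℚ ⋊ N_{≥1}^gp`). No statement of the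
paper is strengthened.
-/

namespace Literature.AlgebraicGeometry.Frobenioids

open CategoryTheory

/-! ### Example 3.5 -/

namespace Ex35

/-- The base category `D` of Ex. 3.5: "a one-object category whose unique object has endomorphism monoid
`𝔽`" (FrdI p. 69). [cite: MochizukiFrdI2008, Ex. 3.5 p.69] -/
abbrev D : Type := SingleObj StandardFrobenioid

/-- The category `C` of Ex. 3.5: one object with endomorphism monoid `𝔽 × 𝔽` (FrdI p. 69).
[cite: MochizukiFrdI2008, Ex. 3.5 p.69] -/
abbrev C : Type := SingleObj (StandardFrobenioid × StandardFrobenioid)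

/-- The second factor of an arrow of `C`, as an element of `𝔽`. [cite: MochizukiFrdI2008, Ex. 3.5 p.69] -/
def snd {A B : C} (φ : A ⟶ B) : StandardFrobenioid := Prod.snd (show StandardFrobenioid × StandardFrobenioid from φ)

/-- The first factor of an arrow of `C`, as an element of `𝔽`. [cite: MochizukiFrdI2008, Ex. 3.5 p.69] -/
def fst {A B : C} (φ : A ⟶ B) : StandardFrobenioid := Prod.fst (show StandardFrobenioid × StandardFrobenioid from φ)

/-- Components of a composite: `(ψ ≫ φ) = φ · ψ` in `𝔽 × 𝔽`. [cite: MochizukiFrdI2008, Ex. 3.5 p.69] -/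
theorem snd_comp {A B B' : C} (ψ : A ⟶ B) (φ : B ⟶ B') : snd (ψ ≫ φ) = snd φ * snd ψ := rfl

/-- Components of a composite, first factor. [cite: MochizukiFrdI2008, Ex. 3.5 p.69] -/
theorem fst_comp {A B B' : C} (ψ : A ⟶ B) (φ : B ⟶ B') : fst (ψ ≫ φ) = fst φ * fst ψ := rfl

/-- The operations of Ex. 3.5: "the projection `𝔽 × 𝔽 → 𝔽` to the first factor determines a functor
`C → D`; `C` may be identified with the elementary Frobenioid determined by the monoid on `D` that assigns
to the unique object of `D` the monoid `ℤ_{≥0}` and to every morphism of `D` the identity" — so `Div` and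
`deg_Fr` are the two coordinates of the second factor `𝔽 = ℤ_{≥0} × N_{≥1}` (FrdI p. 69).
[cite: MochizukiFrdI2008, Ex. 3.5 p.69] -/
def data : PreFrobenioidData.{0} C D where
  base := SingleObj.mapHom _ _ (MonoidHom.fst StandardFrobenioid StandardFrobenioid)
  Mon := fun _ => Multiplicative ℕ
  pull := fun _ => MonoidHom.id _
  pull_id := fun _ _ => rfl
  pull_comp := fun _ _ _ => rfl
  div := fun φ => (snd φ).div
  degFr := fun φ => (snd φ).degFr
  div_id := fun _ => rfl
  div_comp := fun _ _ => rfl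
  degFr_id := fun _ => rfl
  degFr_comp := fun ψ φ => by
    show (snd (ψ ≫ φ)).degFr = (snd ψ).degFr * (snd φ).degFr
    rw [snd_comp, ElemFrobenioidMonoid.mul_degFr, mul_comm]

/-- The self-equivalence of `C` "determined by the automorphism of monoids `𝔽 × 𝔽 ⥲ 𝔽 × 𝔽` given by
switching the two factors" (FrdI pp. 69–70). [cite: MochizukiFrdI2008, Ex. 3.5 p.70] -/
def swap : C ⥤ C := SingleObj.mapHom _ _ (MulEquiv.prodComm : StandardFrobenioid × StandardFrobenioid ≃* _).toMonoidHom

/-- `swap ∘ swap = id`, so `swap` is a self-equivalence. [cite: MochizukiFrdI2008, Ex. 3.5 p.70] -/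
theorem swap_swap : swap ⋙ swap = 𝟭 C := rfl

/-- `swap` as an equivalence of categories. [cite: MochizukiFrdI2008, Ex. 3.5 p.70] -/
def swapEquiv : C ≌ C where
  functor := swap
  inverse := swap
  unitIso := Iso.refl _
  counitIso := Iso.refl _

/-- An isomorphism of the one-object category `D` has underlying element `1 ∈ 𝔽`.
[cite: MochizukiFrdI2008, Ex. 3.5 p.69] -/
theorem eq_one_of_isIso {x y : D} (f : x ⟶ y) [IsIso f] : (show StandardFrobenioid from f) = 1 := by
  have h := IsIso.inv_hom_id f
  rw [SingleObj.comp_as_mul, SingleObj.id_as_one] at h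
  exact StandardFrobenioid.eq_one_of_mul_eq_one h

/-- The arrow `((0,1), (1,1))` of `C`: a pre-step (linear, with base-component the identity) whose image
under `swap`, `((1,1), (0,1))`, has non-invertible base-component. [cite: MochizukiFrdI2008, Ex. 3.5 p.70] -/
def witness : SingleObj.star (StandardFrobenioid × StandardFrobenioid) ⟶ SingleObj.star _ :=
  show StandardFrobenioid × StandardFrobenioid from (1, StandardFrobenioid.gen)

/-- `witness` is a pre-step of `C`. [cite: MochizukiFrdI2008, Ex. 3.5 p.70] -/
theorem isPreStep_witness : data.IsPreStep witness := by
  refine ⟨rfl, ?_⟩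
  show IsIso ((SingleObj.mapHom _ _ (MonoidHom.fst StandardFrobenioid StandardFrobenioid)).map witness)
  have : (SingleObj.mapHom _ _ (MonoidHom.fst StandardFrobenioid StandardFrobenioid)).map witness = 𝟙 _ := rfl
  rw [this]; infer_instance

/-- **Example 3.5**: the switching self-equivalence "clearly fails to preserve pre-steps [cf. Theorem
3.4, (ii)]" (FrdI p. 70; PROVED). [cite: MochizukiFrdI2008, Ex. 3.5 p.70] -/
theorem not_preserves_preSteps : ¬ PreFrobenioidData.PreservesMor swap data.IsPreStep data.IsPreStep := by
  intro h
  obtain ⟨-, hiso⟩ := h witness isPreStep_witness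
  have h1 := @eq_one_of_isIso _ _ _ hiso
  have h2 : (show StandardFrobenioid from data.base.map (swap.map witness)) = StandardFrobenioid.gen := rfl
  rw [h2] at h1
  have h3 := congrArg (fun x : StandardFrobenioid => Multiplicative.toAdd x.div) h1
  simp only [StandardFrobenioid.gen, toAdd_ofAdd] at h3
  exact Nat.one_ne_zero h3

/-- **Example 3.5**, the typed claims (FrdI pp. 69–70): the endomorphism `1 ∈ ℤ_{≥0} ⊆ 𝔽` (i.e.
`γ = (1,1)`) of the unique object of `D` is an FSM-morphism and irreducible, hence `D` admits an
FSMI-endomorphism and fails to be of FSMFF-type; `C` is of Frobenius-normalized and isotropic type and not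
of group-like type ("is a Frobenioid" needs Def. 1.3 / Prop. 1.5 and is added by the wrapper).
FLAG (typer's finding, recorded not asserted against the paper's conclusion): the text's aside "one
verifies immediately that *every* morphism of `D` is an FSM-morphism" does not hold under the §0
definition of fiberwise-surjectivity with composition = multiplication in `𝔽`: see
`Ex35.not_fiberwiseSurjective_sq` below (`β = (0,2)` against `γ = (1,2)`: parity). The example's use —
`D` has an FSMI-endomorphism, hence is not of FSMFF-type — only needs `γ = (1,1)` and is unaffected.
[cite: MochizukiFrdI2008, Ex. 3.5 p.69] -/
def claims : Prop :=
  IsFSMI (show SingleObj.star StandardFrobenioid ⟶ SingleObj.star _ from StandardFrobenioid.gen) ∧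
    ¬ IsOfFSMFFType D ∧
    data.IsOfFrobeniusNormalizedType ∧ data.IsOfIsotropicType ∧ ¬ data.IsOfGroupLikeType

/-- FLAG for Ex. 3.5 (PROVED): in the monoid `𝔽` the equation `(0,2) · x = (1,2) · y` has no solution —
first coordinates `2·x₁` vs `1 + 2·y₁` — so the endomorphism `β = (0,2)` of the unique object of `D`
admits no square `β ∘ δ_B = γ ∘ δ_C` with `γ = (1,2)`, i.e. `β` is not fiberwise-surjective (§0 p. 14)
in the one-object category of `𝔽` (composition = multiplication), contrary to the aside "every morphism
of `D` is an FSM-morphism" (FrdI p. 69). (Multiplicative rendering: `(0,2) = ⟨1, 2⟩`, `(1,2) = ⟨ofAdd 1, 2⟩`.)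
[cite: MochizukiFrdI2008, Ex. 3.5 p.69] -/
theorem not_fiberwiseSurjective_sq :
    ¬ ∃ x y : StandardFrobenioid, (⟨1, 2⟩ : StandardFrobenioid) * x = ⟨Multiplicative.ofAdd 1, 2⟩ * y := by
  rintro ⟨x, y, h⟩
  have h1 := congrArg (fun z : StandardFrobenioid => Multiplicative.toAdd z.div) h
  simp only [ElemFrobenioidMonoid.mul_div, toAdd_mul, toAdd_pow, toAdd_one, toAdd_ofAdd, smul_eq_mul,
    PNat.val_ofNat] at h1
  omega

/-- `C` of Ex. 3.5 is not of group-like type: `Φ = ℤ_{≥0} ≠ 0` (PROVED). [cite: MochizukiFrdI2008, Ex. 3.5 p.69] -/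
theorem not_isGroupLikeType : ¬ data.IsOfGroupLikeType := by
  intro h
  have h0 : (Multiplicative.ofAdd (1 : ℕ) : Multiplicative ℕ) = 1 :=
    h.obj (SingleObj.star _) (Multiplicative.ofAdd (1 : ℕ))
  have h1 := congrArg Multiplicative.toAdd h0
  rw [toAdd_ofAdd, toAdd_one] at h1
  exact Nat.one_ne_zero h1

end Ex35

/-! ### Example 3.10 -/

namespace Ex310

variable (G : Type) [Group G]

/-- The base category `D` of Ex. 3.10: one object with endomorphism monoid a group `G` (FrdI p. 72).
[cite: MochizukiFrdI2008, Ex. 3.10 p.72] -/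
abbrev D : Type := SingleObj G

/-- The category `C` of Ex. 3.10: one object with endomorphism monoid `G × 𝔽` (FrdI p. 72).
[cite: MochizukiFrdI2008, Ex. 3.10 p.72] -/
abbrev C : Type := SingleObj (G × StandardFrobenioid)

variable {G}

/-- The `𝔽`-factor of an arrow of `C`. [cite: MochizukiFrdI2008, Ex. 3.10 p.72] -/
def snd {A B : C G} (φ : A ⟶ B) : StandardFrobenioid := Prod.snd (show G × StandardFrobenioid from φ)

/-- Components of a composite. [cite: MochizukiFrdI2008, Ex. 3.10 p.72] -/
theorem snd_comp {A B B' : C G} (ψ : A ⟶ B) (φ : B ⟶ B') : snd (ψ ≫ φ) = snd φ * snd ψ := rfl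

variable (G)

/-- The operations of Ex. 3.10: base = the projection `G × 𝔽 → G`; `C` "may be identified with the
elementary Frobenioid determined by the monoid on `D` that assigns … the monoid `ℤ_{≥0}` and to every
morphism of `D` the identity" (FrdI p. 72). [cite: MochizukiFrdI2008, Ex. 3.10 p.72] -/
def data : PreFrobenioidData.{0} (C G) (D G) where
  base := SingleObj.mapHom _ _ (MonoidHom.fst G StandardFrobenioid)
  Mon := fun _ => Multiplicative ℕ
  pull := fun _ => MonoidHom.id _
  pull_id := fun _ _ => rfl
  pull_comp := fun _ _ _ => rfl
  div := fun φ => (snd φ).div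
  degFr := fun φ => (snd φ).degFr
  div_id := fun _ => rfl
  div_comp := fun _ _ => rfl
  degFr_id := fun _ => rfl
  degFr_comp := fun ψ φ => by
    show (snd (ψ ≫ φ)).degFr = (snd ψ).degFr * (snd φ).degFr
    rw [snd_comp, ElemFrobenioidMonoid.mul_degFr, mul_comm]

variable {G}

/-- The automorphism of monoids `G × 𝔽 ⥲ G × 𝔽`, `(g, f) ↦ (g · α(f), f)`, for a homomorphism
`α : 𝔽 → Z(G)` (FrdI p. 72) — as an endomorphism of monoids (it is bijective with inverse built from
`f ↦ α(f)⁻¹`). [cite: MochizukiFrdI2008, Ex. 3.10 p.72] -/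
def twistHom (α : StandardFrobenioid →* G) (hα : ∀ f, α f ∈ Subgroup.center G) :
    G × StandardFrobenioid →* G × StandardFrobenioid where
  toFun x := (x.1 * α x.2, x.2)
  map_one' := by simp
  map_mul' x y := by
    refine Prod.ext ?_ rfl
    show x.1 * y.1 * α (x.2 * y.2) = x.1 * α x.2 * (y.1 * α y.2)
    have hc : y.1 * α x.2 = α x.2 * y.1 := Subgroup.mem_center_iff.mp (hα x.2) y.1
    rw [map_mul]
    simp only [mul_assoc]
    congr 1
    rw [← mul_assoc, hc, mul_assoc]

/-- The self-equivalence `C ⥲ C` of Ex. 3.10 determined by `twistHom` (FrdI p. 72).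
[cite: MochizukiFrdI2008, Ex. 3.10 p.72] -/
def twist (α : StandardFrobenioid →* G) (hα : ∀ f, α f ∈ Subgroup.center G) : C G ⥤ C G :=
  SingleObj.mapHom _ _ (twistHom α hα)

/-- **Example 3.10**, the typed claims (FrdI p. 72): `C` is of Frobenius-normalized and isotropic type, not
of group-like type, `D` is of FSM-type; and for a nontrivial `α : 𝔽 → Z(G)` factoring through `𝔽 ↠ N_{≥1}`,
the self-equivalence `twist α` "fails to preserve base-identity endomorphisms of Frobenius type [cf.
Theorem 3.4, (v)]". [cite: MochizukiFrdI2008, Ex. 3.10 p.72] -/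
def claims : Prop :=
  (data G).IsOfFrobeniusNormalizedType ∧ (data G).IsOfIsotropicType ∧ ¬ (data G).IsOfGroupLikeType ∧
    IsOfFSMType (D G) ∧
    ∀ (α : StandardFrobenioid →* G) (hα : ∀ f, α f ∈ Subgroup.center G),
      (∃ β : ℕ+ →* G, α = β.comp StandardFrobenioid.degHom) → α ≠ 1 →
        ∃ (A : C G) (φ : A ⟶ A), (data G).IsBaseIdentity φ ∧ (data G).IsFrobeniusType φ ∧
          ¬ (data G).IsBaseIdentity ((twist α hα).map φ)

end Ex310

end Literature.AlgebraicGeometry.Frobenioids
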